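import Literature.NumberTheory.EllipticCurves.HeckeRingCharacterEigenformProofs
import Literature.NumberTheory.EllipticCurves.CuspFormTwistGamma1
import Literature.NumberTheory.GaloisRepresentations.DirichletCharacterOfGaloisCharacter
import Literature.NumberTheory.GaloisRepresentations.TateTwistFrobeniusProofs
import Literature.NumberTheory.GaloisRepresentations.FramedRepTwistEulerFactorProofs
import Literature.NumberTheory.EllipticCurves.TateModuleTwistNewformEulerFactorsProofs
import HarnessLib

/-!
# Untwisting a finite-order character: a Galois representation whose finite twist carries the
# packet of an eigenform is the representation of a newform (Atkin–Li; proofs only)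

Topic `Literature/NumberTheory/EllipticCurves`; a theorems-only leaf (no definition, no named fact;
D-0026) over `NewformGaloisRepOfEigenformProofs` / `HeckeRingCharacterEigenformProofs` (a semisimple
`ρ : Γ_ℚ → GL₂(ℚ̄_ℓ)` carrying almost everywhere the packet of a cuspidal eigenform, or a `p`-adic
Hecke eigensystem, is the Galois representation of a newform, granted
`Hida2000_thm326_exists_galoisRep`), `CuspFormTwistGamma1` (the newform of the twist of a newform by
a primitive Dirichlet character, `exists_isNewform1_twist`: Shimura 1971, Prop. 3.64 with
Atkin–Lehner–Li, PROVED) and `GaloisRepresentations/DirichletCharacterOfGaloisCharacter`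
(Kronecker–Weber: a character of `Γ_ℚ` with open kernel is a primitive Dirichlet character composed
with a cyclotomic character, PROVED).

* (used) `EllipticCurves.FramedGaloisRep.hasFrobCharpolyAt_twist_two`
  (`TateModuleTwistNewformEulerFactorsProofs`) — in rank `2`, twisting by a character with value
  `c` on the Frobenii above `v` turns the Frobenius polynomial `X² - a X + b` into
  `X² - c a X + c² b`.
* `exists_isNewform1_isGaloisRepOfNewform1_of_eigenform_twist` — **untwisting** (Atkin–Li 1978,
  §3; Shimura 1971, Prop. 3.64): let `ρ : Γ_ℚ → GL₂(ℚ̄_ℓ)` be continuous and irreducible and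
  `ψ : Γ_ℚ → ℚ̄_ℓˣ` a continuous character with OPEN KERNEL (a finite-order character); suppose the
  twist `ρ ⊗ ψ` carries, at all but finitely many places, the packet of a non-zero cuspidal
  eigenform `g ∈ S_k(Γ₁(M))`, `k ≥ 2`, read through `ι : ℚ̄_ℓ ≃ ℂ`.  Then `ρ` ITSELF is the Galois
  representation of a newform of weight `k` (away from `N ℓ`, `N` its level), granted
  `Hida2000_thm326_exists_galoisRep`.  Proof: the packet of `g` is that of a newform `g₁`
  (`exists_isNewform1_of_eigenpacket`); `ι ∘ ψ⁻¹` has open kernel, so it is the Galois character of a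
  primitive Dirichlet character `χ'` (`exists_isPrimitive_dirichletCharacter_eq_dirichletGaloisCharacter`),
  with `ψ⁻¹(Frob_q) = ι⁻¹ χ'(q)` for `q ∤ cond χ'`; the newform `g₂` of `g₁ ⊗ χ'`
  (`exists_isNewform1_twist`: `a_q(g₂) = χ'(q) a_q(g₁)`, `ε_{g₂}(q) = ε_{g₁}(q) χ'(q)²`) has, by the
  previous item applied to `ρ = (ρ ⊗ ψ) ⊗ ψ⁻¹`, the Frobenius polynomials of `ρ` almost everywhere;
  conclude by `exists_isNewform1_isGaloisRepOfNewform1_of_eigenform'`.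
* `exists_isNewform1_isGaloisRepOfNewform1_of_ringHom_heckeRing1_twist` — the same with a `p`-adic
  Hecke eigensystem `θ : 𝕋_ℤ(M, k) → ℚ̄_ℓ` of `ρ ⊗ ψ` as input
  (`exists_eigenform_of_ringHom_heckeRing1`).

These make the dictionary step "arises from an eigenform up to a finite twist ⟹ is the
representation of a newform" available to consumers whose normalisations produce such a twist
(e.g. Pan, arXiv:2209.06366, §7.1.4–§7.2.1, where `ρ_λ ≅ ρ^∨(1) = ρ ⊗ (det ρ)⁻¹ ε` and `det ρ`
is a Tate twist of a finite-order character; the fact file `ProModularDeRhamClassicalGL2Q`,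
rendering (c): "undoing `ψ = ε_p^j χ₀` replaces `f` by the newform of `f ⊗ χ₀⁻¹` (Atkin–Li 1978,
§3)").

## References

* A. O. L. Atkin, W. Li, *Twists of newforms and pseudo-eigenvalues of `W`-operators*, Invent.
  Math. 48 (1978), §3. [AtkinLi1978]
* G. Shimura, *Introduction to the arithmetic theory of automorphic functions* (1971), Prop. 3.64.
  [ShimuraIATAF1971]
* L. C. Washington, *Introduction to Cyclotomic Fields*, GTM 83, Ch. 3 (pp. 19–21). [Washington1997]
* H. Hida, *Modular Forms and Galois Cohomology* (2000), Thm. 3.26 (1), pp. 151–152. [Hida2000]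
* L. Pan, arXiv:2209.06366 (2022), §7.1.4, Thm. 1.1.2 and §7.2.1 (p. 117). [Pan2022LocallyAnalyticII]
-/

noncomputable section

open scoped MatrixGroups ModularForm NumberField

open CongruenceSubgroup UpperHalfPlane Polynomial IsDedekindDomain Field
  Rat.HeightOneSpectrum Literature.NumberTheory.GaloisRepresentations

namespace Literature.NumberTheory.EllipticCurves.ModularForms

/-! ### Untwisting a finite-order character -/

section Untwist

variable {M : ℕ} [NeZero M] {k : ℤ} {ℓ : ℕ} [Fact ℓ.Prime]

/-- **A Galois representation whose twist by a finite-order character carries the packet of a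
cuspidal eigenform is the representation of a newform** (Atkin–Li: the packet of `ρ` is that of the
newform of `g ⊗ χ'`, `χ'` the Dirichlet character of `ψ⁻¹`).  Let `ρ : Γ_ℚ → GL₂(ℚ̄_ℓ)` be
continuous and irreducible, `ψ : Γ_ℚ → ℚ̄_ℓˣ` continuous with open kernel, `ι : ℚ̄_ℓ ≃ ℂ`, and
`g ∈ S_k(Γ₁(M))`, `g ≠ 0`, `k ≥ 2`, with `g ∈ S_k(M, χ)`, `T_q g = a_q g` (`q ∤ M`), such that at all
but finitely many places `ρ ⊗ ψ` is unramified with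
`charpoly (ρ ⊗ ψ)(Frob_q) = X² - ι⁻¹(a_q) X + ι⁻¹(χ(q) q^{k-1})` (arithmetic Frobenius).  Then, granted
`Hida2000_thm326_exists_galoisRep`, there are a newform `f` of weight `k` and some level `N`, and
`ι_f : K_f → ℚ̄_ℓ`, with `ρ` attached to `f` through `ι_f` away from `N ℓ`.  Proof: see the module
docstring — `exists_isNewform1_of_eigenpacket`,
`exists_isPrimitive_dirichletCharacter_eq_dirichletGaloisCharacter` (Kronecker–Weber),
`exists_isNewform1_twist` (Shimura Prop. 3.64), `FramedGaloisRep.hasFrobCharpolyAt_twist_two`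
for `ρ = (ρ ⊗ ψ) ⊗ ψ⁻¹`, and `exists_isNewform1_isGaloisRepOfNewform1_of_eigenform'`.
[cite: AtkinLi1978, §3] [cite: ShimuraIATAF1971, Prop. 3.64] [cite: Washington1997, Ch. 3 (pp. 19–21)]
[cite: Hida2000, Thm. 3.26 (1), pp. 151–152] -/
theorem exists_isNewform1_isGaloisRepOfNewform1_of_eigenform_twist
    (hH : Hida2000_thm326_exists_galoisRep)
    (hk : 2 ≤ k) {g : CuspForm (Gamma1 M) k}
    {χ : DirichletCharacter ℂ M} (hgχ : g ∈ nebentypusSubspace M k χ) (hg0 : g ≠ 0) {a : ℕ → ℂ}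
    (hT : ∀ (p : ℕ) (hp : p.Prime), ¬ p ∣ M →
      (haveI : NeZero p := ⟨hp.ne_zero⟩; heckeT (Gamma1 M) k p g) = a p • g)
    (ι : PadicAlgCl ℓ ≃+* ℂ)
    {ρ : FramedGaloisRep ℚ (PadicAlgCl ℓ) 2} (hρ : ρ.toGaloisRep.IsIrreducible)
    (ψ : absoluteGaloisGroup ℚ →ₜ* (PadicAlgCl ℓ)ˣ)
    (hψ : IsOpen ((ψ.toMonoidHom.ker : Subgroup (absoluteGaloisGroup ℚ)) :
      Set (absoluteGaloisGroup ℚ)))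
    (hc : ∀ᶠ w : HeightOneSpectrum (𝓞 ℚ) in Filter.cofinite,
      FramedGaloisRep.IsUnramifiedAt w (FramedRep.twist ρ ψ) ∧
        FramedGaloisRep.HasFrobCharpolyAt w
          (X ^ 2 - C (ι.symm (a ((primesEquiv w : Nat.Primes) : ℕ))) * X +
            C (ι.symm (χ ((primesEquiv w : Nat.Primes) : ℕ) *
              (((primesEquiv w : Nat.Primes) : ℕ) : ℂ) ^ (k - 1))))
          (FramedRep.twist ρ ψ)) :
    ∃ (N : ℕ) (_ : NeZero N) (f : CuspForm (Gamma1 N) k)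
      (ιf : coeffCharField f →+* PadicAlgCl ℓ),
      IsNewform1 f ∧ IsGaloisRepOfNewform1 f ιf {q | q ∣ N * ℓ} ρ := by
  classical
  -- Step 1 (Atkin–Lehner–Li): the packet of `g` is the packet of a newform `g₁` of level `M₁ ∣ M`
  obtain ⟨M₁, _, hM₁, g₁, hg₁, hcoeff₁, hχ₁⟩ :=
    exists_isNewform1_of_eigenpacket hg0 hgχ (a := a) hT
  -- Step 2 (Kronecker–Weber): `ι ∘ ψ⁻¹` is the Galois character of a primitive Dirichlet `χ'`
  set ψℂ : absoluteGaloisGroup ℚ →* ℂˣ :=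
    (Units.map ((ι : PadicAlgCl ℓ →+* ℂ) : PadicAlgCl ℓ →* ℂ)).comp ψ.toMonoidHom with hψℂ
  have hker : ((ψℂ⁻¹).ker : Set (absoluteGaloisGroup ℚ)) = ψ.toMonoidHom.ker := by
    ext σ
    simp only [SetLike.mem_coe, MonoidHom.mem_ker, MonoidHom.inv_apply, inv_eq_one, hψℂ,
      MonoidHom.coe_comp, Function.comp_apply, ContinuousMonoidHom.coe_toMonoidHom]
    rw [← Units.val_eq_one, Units.coe_map, ← Units.val_eq_one]
    exact map_eq_one_iff _ (ι : PadicAlgCl ℓ →+* ℂ).injective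
  have hopen : IsOpen (((ψℂ⁻¹).ker : Subgroup (absoluteGaloisGroup ℚ)) :
      Set (absoluteGaloisGroup ℚ)) := by
    rw [hker]; exact hψ
  obtain ⟨m, _, χ', hprim, hχ'⟩ :=
    exists_isPrimitive_dirichletCharacter_eq_dirichletGaloisCharacter ψℂ⁻¹ hopen
  -- values of `ψ⁻¹`: `ι⁻¹ χ'(q)` on the Frobenii above `q ∤ m`, `1` on the inertia there
  have hψinv : ∀ σ : absoluteGaloisGroup ℚ,
      ((ψ⁻¹ σ : (PadicAlgCl ℓ)ˣ) : PadicAlgCl ℓ) =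
        ι.symm (((dirichletGaloisCharacter ℚ χ' σ : ℂˣ) : ℂ)) := by
    intro σ
    have e := hχ' σ
    simp only [MonoidHom.inv_apply, hψℂ, MonoidHom.coe_comp, Function.comp_apply,
      ContinuousMonoidHom.coe_toMonoidHom, Units.val_inv_eq_inv_val, Units.coe_map,
      MonoidHom.coe_coe, RingEquiv.coe_toRingHom] at e
    rw [← e, map_inv₀, RingEquiv.symm_apply_apply]
    change (((ψ σ)⁻¹ : (PadicAlgCl ℓ)ˣ) : PadicAlgCl ℓ) = _
    exact Units.val_inv_eq_inv_val (ψ σ)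
  have hfrob : ∀ (w : HeightOneSpectrum (𝓞 ℚ)), ¬ ((primesEquiv w : Nat.Primes) : ℕ) ∣ m →
      ∀ 𝔓 ∈ w.primesAbove, ∀ σ : absoluteGaloisGroup ℚ, IsArithFrobAt (𝓞 ℚ) σ 𝔓 →
        ((ψ⁻¹ σ : (PadicAlgCl ℓ)ˣ) : PadicAlgCl ℓ) =
          ι.symm (χ' (((primesEquiv w : Nat.Primes) : ℕ) : ZMod m)) := by
    intro w hwm 𝔓 h𝔓 σ hσ
    rw [hψinv σ, FramedRep.coe_dirichletGaloisCharacter_of_isArithFrobAt χ' h𝔓 hwm hσ]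
  have hinert : ∀ (w : HeightOneSpectrum (𝓞 ℚ)), ¬ ((primesEquiv w : Nat.Primes) : ℕ) ∣ m →
      ∀ 𝔓 ∈ w.primesAbove, ∀ σ ∈ 𝔓.inertia (absoluteGaloisGroup ℚ), ψ⁻¹ σ = 1 := by
    intro w hwm 𝔓 h𝔓 σ hσ
    apply Units.ext
    rw [hψinv σ, FramedRep.dirichletGaloisCharacter_eq_one_of_mem_inertia χ' h𝔓 hwm hσ, Units.val_one,
      Units.val_one, map_one]
  -- Step 3 (Shimura Prop. 3.64): the newform `g₂` of `g₁ ⊗ χ'`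
  obtain ⟨N₂, _, -, g₂, hg₂, htw⟩ := exists_isNewform1_twist hg₁ hprim
  -- Step 4: `ρ = (ρ ⊗ ψ) ⊗ ψ⁻¹` carries the packet of `g₂` almost everywhere
  have hρss : ρ.toGaloisRep.IsSemisimple := by
    haveI : ρ.toGaloisRep.toRepresentation.IsIrreducible := hρ
    change ρ.toGaloisRep.toRepresentation.IsSemisimpleRepresentation
    infer_instance
  have key : ∀ᶠ w : HeightOneSpectrum (𝓞 ℚ) in Filter.cofinite,
      ρ.IsUnramifiedAt w ∧
        ρ.HasFrobCharpolyAt w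
          (X ^ 2 - C (ι.symm (cuspCoeff g₂ ((primesEquiv w : Nat.Primes) : ℕ))) * X +
            C (ι.symm (nebentypus g₂ ((primesEquiv w : Nat.Primes) : ℕ) *
              (((primesEquiv w : Nat.Primes) : ℕ) : ℂ) ^ (k - 1)))) := by
    filter_upwards [hc,
      (DeligneSerre1974.finite_setOf_primesEquiv_dvd (NeZero.ne M)).eventually_cofinite_notMem,
      (DeligneSerre1974.finite_setOf_primesEquiv_dvd (NeZero.ne m)).eventually_cofinite_notMem]
      with w hw hwM hwm
    have hqp : ((primesEquiv w : Nat.Primes) : ℕ).Prime := (primesEquiv w).2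
    have hqM₁m : ¬ ((primesEquiv w : Nat.Primes) : ℕ) ∣ M₁ * m := fun h ↦ by
      rcases (Nat.Prime.dvd_mul hqp).1 h with h' | h'
      · exact hwM (h'.trans hM₁)
      · exact hwm h'
    obtain ⟨ha₂, hε₂⟩ := htw _ hqp hqM₁m
    -- the packet of `g₁` at `q`
    have ha₁ : cuspCoeff g₁ ((primesEquiv w : Nat.Primes) : ℕ) = a ((primesEquiv w : Nat.Primes) : ℕ) :=
      hcoeff₁ _ hqp hwM
    have hcop : IsCoprime (((primesEquiv w : Nat.Primes) : ℕ) : ℤ) (M : ℤ) :=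
      Nat.isCoprime_iff_coprime.mpr ((Nat.Prime.coprime_iff_not_dvd hqp).mpr hwM)
    have hε₁ : nebentypus g₁ (((primesEquiv w : Nat.Primes) : ℕ) : ZMod M₁) =
        χ (((primesEquiv w : Nat.Primes) : ℕ) : ZMod M) := by
      have := DirichletCharacter.changeLevel_eq_cast_of_dvd' (nebentypus g₁) hM₁ hcop
      rw [hχ₁] at this
      simpa using this.symm
    -- the polynomial of `g₂`'s packet is the rescaled polynomial
    have hpol :
        (X ^ 2 - C (ι.symm (cuspCoeff g₂ ((primesEquiv w : Nat.Primes) : ℕ))) * X +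
            C (ι.symm (nebentypus g₂ ((primesEquiv w : Nat.Primes) : ℕ) *
              (((primesEquiv w : Nat.Primes) : ℕ) : ℂ) ^ (k - 1))) : (PadicAlgCl ℓ)[X]) =
          X ^ 2 - C (ι.symm (χ' (((primesEquiv w : Nat.Primes) : ℕ) : ZMod m)) *
              ι.symm (a ((primesEquiv w : Nat.Primes) : ℕ))) * X +
            C (ι.symm (χ' (((primesEquiv w : Nat.Primes) : ℕ) : ZMod m)) ^ 2 *
              ι.symm (χ ((primesEquiv w : Nat.Primes) : ℕ) *
                (((primesEquiv w : Nat.Primes) : ℕ) : ℂ) ^ (k - 1))) := by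
      rw [ha₂, ha₁, hε₂, hε₁]
      simp only [map_mul, map_pow]
      ring
    refine ⟨?_, ?_⟩
    · rw [← FramedRep.twist_twist_inv ρ ψ]
      exact FramedGaloisRep.isUnramifiedAt_twist hw.1 (hinert w hwm)
    · have h2 := EllipticCurves.FramedGaloisRep.hasFrobCharpolyAt_twist_two hw.2 (hfrob w hwm)
      rw [FramedRep.twist_twist_inv] at h2
      rw [hpol]
      exact h2
  -- Step 5: `g₂` is an eigenform of its own packet; conclude
  have hg₂χ : g₂ ∈ nebentypusSubspace N₂ k (nebentypus g₂) :=
    IsNewform1.mem_nebentypusSubspace_nebentypus_holds hg₂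
  have hT₂ : ∀ (p : ℕ) (hp : p.Prime), ¬ p ∣ N₂ →
      (haveI : NeZero p := ⟨hp.ne_zero⟩; heckeT (Gamma1 N₂) k p g₂) = cuspCoeff g₂ p • g₂ :=
    fun p hp _ ↦ by
      haveI : NeZero p := ⟨hp.ne_zero⟩
      exact hg₂.heckeT_apply_eq_cuspCoeff_smul p hp
  exact exists_isNewform1_isGaloisRepOfNewform1_of_eigenform' hH hk hg₂χ hg₂.ne_zero hT₂ ι hρss key

/-- **The same with a `p`-adic Hecke eigensystem of the twist as input**: if `θ : 𝕋_ℤ(M, k) → ℚ̄_ℓ`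
(`heckeRing1 M k`, `k ≥ 2`) is a ring homomorphism with
`charpoly (ρ ⊗ ψ)(Frob_q) = X² - θ(T_q) X + q^{k-1} θ(⟨q⟩)` at all but finitely many `q`
(`(PadicHeckeAlgebra.frobPoly ℓ M k q).map (lift θ)`), `ρ` irreducible and `ψ` of open kernel, then
`ρ` is the Galois representation of a newform of weight `k`, granted
`Hida2000_thm326_exists_galoisRep` (`exists_eigenform_of_ringHom_heckeRing1` through any
`ι : ℚ̄_ℓ ≃ ℂ`, then `exists_isNewform1_isGaloisRepOfNewform1_of_eigenform_twist`).
[cite: AtkinLi1978, §3] [cite: Hida2000, Thm. 3.17, §3.2.1 (pp. 143–144) and Thm. 3.26 (1)] -/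
theorem exists_isNewform1_isGaloisRepOfNewform1_of_ringHom_heckeRing1_twist
    (hH : Hida2000_thm326_exists_galoisRep) {n : ℕ}
    (θ : heckeRing1 M (n + 2) →+* PadicAlgCl ℓ)
    {ρ : FramedGaloisRep ℚ (PadicAlgCl ℓ) 2} (hρ : ρ.toGaloisRep.IsIrreducible)
    (ψ : absoluteGaloisGroup ℚ →ₜ* (PadicAlgCl ℓ)ˣ)
    (hψ : IsOpen ((ψ.toMonoidHom.ker : Subgroup (absoluteGaloisGroup ℚ)) :
      Set (absoluteGaloisGroup ℚ)))
    (hc : ∀ᶠ w : HeightOneSpectrum (𝓞 ℚ) in Filter.cofinite,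
      FramedGaloisRep.IsUnramifiedAt w (FramedRep.twist ρ ψ) ∧
        FramedGaloisRep.HasFrobCharpolyAt w
          ((PadicHeckeAlgebra.frobPoly ℓ M (n + 2) (primesEquiv w)).map
            (PadicHeckeAlgebra.lift ℓ θ : PadicHeckeAlgebra ℓ M (n + 2) →+* PadicAlgCl ℓ))
          (FramedRep.twist ρ ψ)) :
    ∃ (N : ℕ) (_ : NeZero N) (f : CuspForm (Gamma1 N) (n + 2))
      (ιf : coeffCharField f →+* PadicAlgCl ℓ),
      IsNewform1 f ∧ IsGaloisRepOfNewform1 f ιf {q | q ∣ N * ℓ} ρ := by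
  classical
  obtain ⟨ι⟩ := PadicAlgCl.nonempty_ringEquiv_complex ℓ
  set θℂ : heckeRing1 M (n + 2) →+* ℂ := (ι : PadicAlgCl ℓ →+* ℂ).comp θ with hθℂ
  obtain ⟨g, χ, hg0, hgχ, hχ, hT⟩ := exists_eigenform_of_ringHom_heckeRing1 θℂ
  have hk : (2 : ℤ) ≤ (n : ℤ) + 2 := by omega
  set a : ℕ → ℂ := fun q ↦ if hq : q.Prime then θℂ (heckeRing1.T M (n + 2) ⟨q, hq⟩) else 0
    with hadef
  have hT' : ∀ (q : ℕ) (hq : q.Prime), ¬ q ∣ M →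
      (haveI : NeZero q := ⟨hq.ne_zero⟩; heckeT (Gamma1 M) (n + 2) q g) = a q • g := by
    intro q hq _
    rw [hT q hq, hadef]
    simp only [dif_pos hq]
  have hpoly : ∀ w : HeightOneSpectrum (𝓞 ℚ), ¬ ((primesEquiv w : Nat.Primes) : ℕ) ∣ M →
      (PadicHeckeAlgebra.frobPoly ℓ M (n + 2) (primesEquiv w)).map
          (PadicHeckeAlgebra.lift ℓ θ : PadicHeckeAlgebra ℓ M (n + 2) →+* PadicAlgCl ℓ) =
        X ^ 2 - C (ι.symm (a ((primesEquiv w : Nat.Primes) : ℕ))) * X +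
          C (ι.symm (χ ((primesEquiv w : Nat.Primes) : ℕ) *
            (((primesEquiv w : Nat.Primes) : ℕ) : ℂ) ^ ((n : ℤ) + 2 - 1))) := by
    intro w hwM
    rw [PadicHeckeAlgebra.map_frobPoly_lift]
    have hqp : ((primesEquiv w : Nat.Primes) : ℕ).Prime := (primesEquiv w).2
    have hprim : (⟨((primesEquiv w : Nat.Primes) : ℕ), hqp⟩ : Nat.Primes) = primesEquiv w := rfl
    have ha : ι.symm (a ((primesEquiv w : Nat.Primes) : ℕ)) =
        θ (heckeRing1.T M (n + 2) (primesEquiv w)) := by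
      rw [hadef]
      simp only [dif_pos hqp, hθℂ, RingHom.coe_comp, RingHom.coe_coe, Function.comp_apply,
        RingEquiv.symm_apply_apply, hprim]
    obtain ⟨u, hu⟩ : IsUnit ((((primesEquiv w : Nat.Primes) : ℕ) : ZMod M)) :=
      (ZMod.isUnit_prime_iff_not_dvd hqp).mpr hwM
    have hχq : ι.symm (χ (((primesEquiv w : Nat.Primes) : ℕ) : ZMod M)) =
        θ (heckeRing1.diamond M (n + 2) (((primesEquiv w : Nat.Primes) : ℕ) : ZMod M)) := by
      rw [← hu, hχ u, hθℂ, RingHom.coe_comp, RingHom.coe_coe, Function.comp_apply,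
        RingEquiv.symm_apply_apply]
    rw [ha, map_mul ι.symm, hχq]
    simp only [map_zpow₀, map_natCast]
    ring
  have hc' : ∀ᶠ w : HeightOneSpectrum (𝓞 ℚ) in Filter.cofinite,
      FramedGaloisRep.IsUnramifiedAt w (FramedRep.twist ρ ψ) ∧
        FramedGaloisRep.HasFrobCharpolyAt w
          (X ^ 2 - C (ι.symm (a ((primesEquiv w : Nat.Primes) : ℕ))) * X +
            C (ι.symm (χ ((primesEquiv w : Nat.Primes) : ℕ) *
              (((primesEquiv w : Nat.Primes) : ℕ) : ℂ) ^ ((n : ℤ) + 2 - 1))))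
          (FramedRep.twist ρ ψ) := by
    filter_upwards [hc,
      (DeligneSerre1974.finite_setOf_primesEquiv_dvd (NeZero.ne M)).eventually_cofinite_notMem]
      with w hw hwM
    exact ⟨hw.1, hpoly w hwM ▸ hw.2⟩
  exact exists_isNewform1_isGaloisRepOfNewform1_of_eigenform_twist hH hk hgχ hg0 hT' ι hρ ψ hψ hc'

end Untwist

end Literature.NumberTheory.EllipticCurves.ModularForms
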